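import Literature.Computability.QuantumComplexity.CubicForrelation
import HarnessLib

/-!
# Centroids and moments of signed point sets in `𝔽₂^m` (NearExactIsExact, disprover's toolkit, gen 16)

Generic, problem-independent lemmas used by `Negative.NoCaseAMM59` (THEOREM MM59: no Maiorana–McFarland cubic over a
quadratic map is case A at `n = 14`). HONEST FRAMING: elementary finite-field bookkeeping, NOT summit progress.

* Integer characters `(-1)^{b·y}` (`zt`, an integer copy of `twist`) and the **mod-4 law** `charSum_sub_dvd_four`:
  for odd weights `ε` with odd total `S`, `Σ_{y∈A} ε_y (-1)^{b·y} ≡ S (-1)^{b·c(A)} (mod 4)`, `c(A) = Σ_{y∈A} y` the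
  CENTROID of `A`.
* `𝔽₂` counting through the algebraic normal form (`eval_pt_eq`, `natCast_card_filter_expand`): a point set meeting
  the moment condition `#{y ∈ A : y ⊇ T} ≡ [c ⊇ T] (mod 2)`, `|T| ≤ 2`, counts every quadratic `r` as
  `#{y ∈ A : r(y)=1} ≡ r(c) (mod 2)` (`natCast_card_filter_quadratic`); a function of degree `< m` on `m` variables
  has even weight (`natCast_card_eq_zero_of_isDegLeFun`); closure of `IsDegLeFun` under negation and conjunction.
* **Lemma FOUR** (`four_points`): no four distinct points of `𝔽₂^m` have all coordinate sums and all pairwise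
  coordinate-product sums even.

Sources (orientation): C. Carlet, Boolean Functions for Cryptography and Coding Theory (2020) §2.2 (ANF, degree and
weight parity); R. O'Donnell, Analysis of Boolean Functions (2014) §1.4. Axioms: the standard three.
-/

set_option linter.dupNamespace false -- D-0017: single-problem summit ⇒ `QuantumAdvantage.QuantumAdvantage` by design

namespace Summit.QuantumAdvantage.QuantumAdvantage.Theorems.NearExactIsExact.Negative.CentroidMoments

open Finset
open Literature.Computability.QuantumComplexity

variable {m : ℕ}

/-! ### Integer characters of `𝔽₂^m` -/

/-- The integer character `(-1)^{b·y} = ∏ⱼ (-1)^{bⱼ yⱼ}` (an integer copy of `twist`). [folklore] -/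
def zt (b y : Fin m → Bool) : ℤ := ∏ j, if b j && y j then -1 else 1

/-- The overlap `|b ∧ y| = #{j : bⱼ = yⱼ = 1}`. [folklore] -/
def ov (b y : Fin m → Bool) : ℕ := #{j | b j && y j}

/-- `(-1)^{b·y} = (-1)^{|b ∧ y|}`. [folklore] -/
theorem zt_eq_pow (b y : Fin m → Bool) : zt b y = (-1) ^ ov b y := by
  unfold zt ov
  rw [Finset.prod_ite, Finset.prod_const_one, mul_one, Finset.prod_const]

/-- `(-1)^{b·y}` as a real number is `twist b y`. [folklore] -/
theorem cast_zt (b y : Fin m → Bool) : (zt b y : ℝ) = twist b y := by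
  unfold zt twist
  push_cast
  exact Finset.prod_congr rfl fun j _ => by split_ifs <;> simp

/-- `(-1)^{b·y} ∈ {1, -1}`. [folklore] -/
theorem zt_eq_one_or (b y : Fin m → Bool) : zt b y = 1 ∨ zt b y = -1 := by
  rw [zt_eq_pow]
  rcases Nat.even_or_odd (ov b y) with h | h
  · exact Or.inl h.neg_one_pow
  · exact Or.inr h.neg_one_pow

/-- `(-1)^{0·y} = 1`. [folklore] -/
theorem zt_zero (y : Fin m → Bool) : zt (fun _ => false) y = 1 := by
  unfold zt
  simp

/-- Symmetry `(-1)^{b·y} = (-1)^{y·b}`. [folklore] -/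
theorem zt_comm (b y : Fin m → Bool) : zt b y = zt y b := by
  unfold zt
  exact Finset.prod_congr rfl fun j _ => by rw [Bool.and_comm]

/-- Multiplicativity `(-1)^{(b ⊕ b')·y} = (-1)^{b·y} (-1)^{b'·y}`. [folklore] -/
theorem zt_xor (b b' y : Fin m → Bool) : zt (fun j => xor (b j) (b' j)) y = zt b y * zt b' y := by
  have key : ∀ p q r : Bool, (if (xor p q && r) then (-1 : ℤ) else 1) =
      (if p && r then (-1 : ℤ) else 1) * (if q && r then (-1 : ℤ) else 1) := by decide
  unfold zt
  rw [← Finset.prod_mul_distrib]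
  exact Finset.prod_congr rfl fun j _ => key (b j) (b' j) (y j)

/-- The unit vector `eⱼ`. [folklore] -/
def unitVec (j : Fin m) : Fin m → Bool := fun i => decide (i = j)

/-- `(-1)^{eⱼ·y} = (-1)^{yⱼ}`. [folklore] -/
theorem zt_unitVec (j : Fin m) (y : Fin m → Bool) : zt (unitVec j) y = if y j then -1 else 1 := by
  unfold zt unitVec
  rw [Finset.prod_eq_single j]
  · simp
  · intro i _ hij
    simp [hij]
  · simp

/-- `(-1)^k ≡ 1 - 2k (mod 4)`. [folklore] -/
theorem neg_one_pow_sub_dvd (k : ℕ) : (4 : ℤ) ∣ (-1) ^ k - (1 - 2 * (k : ℤ)) := by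
  rcases Nat.even_or_odd k with ⟨t, rfl⟩ | ⟨t, rfl⟩
  · rw [← two_mul, pow_mul, neg_one_sq, one_pow]
    exact ⟨t, by push_cast; ring⟩
  · rw [pow_succ, pow_mul, neg_one_sq, one_pow]
    exact ⟨t, by push_cast; ring⟩

/-- The overlap as a sum of indicators. [folklore] -/
theorem ov_eq_sum (b y : Fin m → Bool) : (ov b y : ℤ) = ∑ j, if b j && y j then (1 : ℤ) else 0 := by
  unfold ov
  rw [Finset.card_filter]
  push_cast
  rfl

/-! ### The centroid of a finite set of points and the mod-4 law of signed character sums -/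

/-- The coordinate counts `N_j(A) = #{y ∈ A : yⱼ = 1}`. [folklore] -/
def coordCount (A : Finset (Fin m → Bool)) (j : Fin m) : ℕ := #{y ∈ A | y j}

/-- The centroid `c(A) = Σ_{y ∈ A} y ∈ 𝔽₂^m` (coordinatewise parity of the counts). [folklore] -/
def cen (A : Finset (Fin m → Bool)) : Fin m → Bool := fun j => decide (Odd (coordCount A j))

/-- `Σ_{y∈A} |b ∧ y| = Σ_j [bⱼ] N_j(A)` (double counting). [folklore] -/
theorem sum_ov_eq (A : Finset (Fin m → Bool)) (b : Fin m → Bool) :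
    ∑ y ∈ A, (ov b y : ℤ) = ∑ j, if b j then (coordCount A j : ℤ) else 0 := by
  simp_rw [ov_eq_sum]
  rw [Finset.sum_comm]
  refine Finset.sum_congr rfl fun j _ => ?_
  unfold coordCount
  rw [Finset.card_filter]
  push_cast
  cases b j
  · simp
  · simp

/-- `|b ∧ c(A)| ≡ Σ_j [bⱼ] N_j(A) (mod 2)`. [folklore] -/
theorem ov_cen_dvd (A : Finset (Fin m → Bool)) (b : Fin m → Bool) :
    (2 : ℤ) ∣ (ov b (cen A) : ℤ) - ∑ j, if b j then (coordCount A j : ℤ) else 0 := by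
  rw [ov_eq_sum, ← Finset.sum_sub_distrib]
  refine Finset.dvd_sum fun j _ => ?_
  unfold cen
  cases b j
  · simp
  · simp only [Bool.true_and, decide_eq_true_eq, ite_true]
    by_cases h : Odd (coordCount A j)
    · rw [if_pos (by simpa using h)]
      obtain ⟨t, ht⟩ := h
      exact ⟨-t, by rw [ht]; push_cast; ring⟩
    · rw [if_neg (by simpa using h)]
      rw [Nat.not_odd_iff_even] at h
      obtain ⟨t, ht⟩ := h
      exact ⟨-t, by rw [ht]; push_cast; ring⟩

/-- **Mod-4 law.** For odd weights `ε` with odd total `S = Σ_{y∈A} ε_y`, every signed character sum satisfies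
`Σ_{y∈A} ε_y (-1)^{b·y} ≡ S · (-1)^{b·c(A)} (mod 4)`, `c(A)` the centroid. [folklore] -/
theorem charSum_sub_dvd_four (A : Finset (Fin m → Bool)) (ε : (Fin m → Bool) → ℤ) (hε : ∀ y, Odd (ε y))
    (hS : Odd (∑ y ∈ A, ε y)) (b : Fin m → Bool) :
    (4 : ℤ) ∣ ∑ y ∈ A, ε y * zt b y - (∑ y ∈ A, ε y) * zt b (cen A) := by
  set K : ℤ := ∑ j, if b j then (coordCount A j : ℤ) else 0 with hK
  set S : ℤ := ∑ y ∈ A, ε y with hSdef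
  -- (1) LHS sum ≡ S - 2K
  have h1 : (4 : ℤ) ∣ ∑ y ∈ A, ε y * zt b y - (S - 2 * K) := by
    have e : ∑ y ∈ A, ε y * zt b y - (S - 2 * K) =
        ∑ y ∈ A, (ε y * (zt b y - (1 - 2 * (ov b y : ℤ))) - 2 * (ov b y : ℤ) * (ε y - 1)) := by
      rw [hSdef, hK, ← sum_ov_eq, Finset.mul_sum, ← Finset.sum_sub_distrib, ← Finset.sum_sub_distrib]
      exact Finset.sum_congr rfl fun y _ => by ring
    rw [e]
    refine Finset.dvd_sum fun y _ => dvd_sub ?_ ?_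
    · exact Dvd.dvd.mul_left (by rw [zt_eq_pow]; exact neg_one_pow_sub_dvd _) _
    · obtain ⟨t, ht⟩ := hε y
      exact ⟨ov b y * t, by rw [ht]; ring⟩
  -- (2) S * zt b (cen A) ≡ S - 2K
  have h2 : (4 : ℤ) ∣ S * zt b (cen A) - (S - 2 * K) := by
    obtain ⟨t, ht⟩ := ov_cen_dvd A b
    have ht' : (ov b (cen A) : ℤ) - K = 2 * t := by rw [hK]; exact ht
    obtain ⟨s, hs⟩ := hS
    have e : S * zt b (cen A) - (S - 2 * K) =
        S * (zt b (cen A) - (1 - 2 * (ov b (cen A) : ℤ))) - 2 * S * ((ov b (cen A) : ℤ) - K)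
          + 2 * K * (1 - S) := by ring
    rw [e, ht']
    refine dvd_add (dvd_sub ?_ ⟨S * t, by ring⟩) ⟨-(K * s), by rw [hs]; ring⟩
    exact Dvd.dvd.mul_left (by rw [zt_eq_pow]; exact neg_one_pow_sub_dvd _) _
  have e : ∑ y ∈ A, ε y * zt b y - S * zt b (cen A) =
      (∑ y ∈ A, ε y * zt b y - (S - 2 * K)) - (S * zt b (cen A) - (S - 2 * K)) := by ring
  rw [e]
  exact dvd_sub h1 h2

/-! ### `ZMod 2` bookkeeping: monomial expansion of low-degree Boolean functions -/

/-- The `𝔽₂`-point of `x ∈ {0,1}^m` (the assignment used by `polyPhase`). [folklore] -/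
def pt (x : Fin m → Bool) : Fin m → ZMod 2 := fun j => if x j then 1 else 0

/-- The `𝔽₂`-valued indicator of `f = polyPhase p` is the evaluation of `p`. [folklore] -/
theorem indicator_eq_eval {p : MvPolynomial (Fin m) (ZMod 2)} {f : (Fin m → Bool) → Bool}
    (hf : ∀ x, f x = polyPhase p x) (x : Fin m → Bool) :
    (if f x then (1 : ZMod 2) else 0) = MvPolynomial.eval (pt x) p := by
  rw [hf x, polyPhase_apply, show (fun j => if x j then (1 : ZMod 2) else 0) = pt x from rfl]
  rcases (by decide : ∀ z : ZMod 2, z = 0 ∨ z = 1) (MvPolynomial.eval (pt x) p) with h | h <;> rw [h] <;> decide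

/-- **Monomial expansion** at a `0/1` point: `p(x) = Σ_d coeff_d(p) · [supp d ⊆ supp x]`. [folklore] -/
theorem eval_pt_eq (p : MvPolynomial (Fin m) (ZMod 2)) (x : Fin m → Bool) :
    MvPolynomial.eval (pt x) p =
      ∑ d ∈ p.support, p.coeff d * (if ∀ i ∈ d.support, x i then 1 else 0) := by
  rw [MvPolynomial.eval_eq]
  refine Finset.sum_congr rfl fun d _ => ?_
  congr 1
  by_cases h : ∀ i ∈ d.support, x i
  · rw [if_pos h]
    exact Finset.prod_eq_one fun i hi => by simp [pt, h i hi]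
  · rw [if_neg h]
    obtain ⟨i, hi, hxi⟩ : ∃ i ∈ d.support, x i = false := by simpa using h
    exact Finset.prod_eq_zero hi (by simp [pt, hxi, Finsupp.mem_support_iff.mp hi])

/-- A monomial of a polynomial of total degree `≤ d` involves at most `d` variables. [folklore] -/
theorem card_support_le {p : MvPolynomial (Fin m) (ZMod 2)} {d : ℕ} (hp : p.totalDegree ≤ d)
    {s : Fin m →₀ ℕ} (hs : s ∈ p.support) : #s.support ≤ d := by
  refine le_trans ?_ ((MvPolynomial.le_totalDegree hs).trans hp)
  simp only [Finsupp.sum, Finset.card_eq_sum_ones]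
  exact Finset.sum_le_sum fun i hi => Nat.one_le_iff_ne_zero.mpr (Finsupp.mem_support_iff.mp hi)

/-- Counting mod 2 is summing indicators in `𝔽₂`. [folklore] -/
theorem natCast_card_filter_eq_sum (A : Finset (Fin m → Bool)) (P : (Fin m → Bool) → Prop)
    [DecidablePred P] : ((#{y ∈ A | P y} : ℕ) : ZMod 2) = ∑ y ∈ A, if P y then (1 : ZMod 2) else 0 := by
  rw [Finset.card_filter]
  push_cast
  rfl

/-- **Counting lemma.** `#{y ∈ A : f(y) = 1} ≡ Σ_d coeff_d(p) · #{y ∈ A : supp d ⊆ supp y} (mod 2)` for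
`f = polyPhase p`. [folklore] -/
theorem natCast_card_filter_expand {p : MvPolynomial (Fin m) (ZMod 2)} {f : (Fin m → Bool) → Bool}
    (hf : ∀ x, f x = polyPhase p x) (A : Finset (Fin m → Bool)) :
    ((#{y ∈ A | f y} : ℕ) : ZMod 2) =
      ∑ d ∈ p.support, p.coeff d * ((#{y ∈ A | ∀ i ∈ d.support, y i} : ℕ) : ZMod 2) := by
  rw [natCast_card_filter_eq_sum]
  simp_rw [indicator_eq_eval hf, eval_pt_eq]
  rw [Finset.sum_comm]
  refine Finset.sum_congr rfl fun d _ => ?_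
  rw [← Finset.mul_sum, natCast_card_filter_eq_sum]

/-- **Counting quadratics from moments.** If a point set `A ⊆ 𝔽₂^m` and a point `c` satisfy the moment
condition `#{y ∈ A : y ⊇ S} ≡ [c ⊇ S] (mod 2)` for all `|S| ≤ 2`, then every quadratic Boolean function `r`
has `#{y ∈ A : r(y) = 1} ≡ r(c) (mod 2)` (expand `r` into monomials of degree `≤ 2`). [folklore] -/
theorem natCast_card_filter_quadratic {A : Finset (Fin m → Bool)} {c : Fin m → Bool}
    (hM : ∀ S : Finset (Fin m), #S ≤ 2 →
      ((#{y ∈ A | ∀ i ∈ S, y i} : ℕ) : ZMod 2) = if (∀ i ∈ S, c i) then 1 else 0)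
    {r : (Fin m → Bool) → Bool} (hr : IsDegLeFun 2 r) :
    ((#{y ∈ A | r y} : ℕ) : ZMod 2) = if r c then 1 else 0 := by
  obtain ⟨p, hp, hrp⟩ := hr
  rw [natCast_card_filter_expand hrp, indicator_eq_eval hrp, eval_pt_eq]
  refine Finset.sum_congr rfl fun d hd => ?_
  rw [hM d.support (card_support_le hp hd)]

/-- A cylinder set `{y : y ⊇ S}` with a free coordinate `i₀ ∉ S` has even size (flip `y_{i₀}`). [folklore] -/
theorem natCast_card_cylinder_eq_zero (S : Finset (Fin m)) {i₀ : Fin m} (hi₀ : i₀ ∉ S) :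
    ((#{y : Fin m → Bool | ∀ i ∈ S, y i} : ℕ) : ZMod 2) = 0 := by
  rw [natCast_card_filter_eq_sum]
  refine Finset.sum_ninvolution (fun y => Function.update y i₀ (!y i₀)) ?_ ?_ (fun _ => Finset.mem_univ _) ?_
  · intro y
    have hiff : (∀ i ∈ S, Function.update y i₀ (!y i₀) i = true) ↔ (∀ i ∈ S, y i = true) := by
      refine forall₂_congr fun i hi => ?_
      rw [Function.update_of_ne (show i ≠ i₀ by rintro rfl; exact hi₀ hi)]
    simp only [hiff]
    split_ifs <;> decide
  · intro y _ h
    have := congr_fun h i₀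
    simp at this
  · intro y
    ext i
    by_cases h : i = i₀
    · subst h
      simp
    · simp [Function.update_of_ne h]

/-- **Even weight below full degree**: a Boolean function on `m` variables of algebraic degree `< m`
takes the value `1` an even number of times. [folklore] -/
theorem natCast_card_eq_zero_of_isDegLeFun {d : ℕ} {F : (Fin m → Bool) → Bool} (hF : IsDegLeFun d F)
    (hd : d < m) : ((#{y : Fin m → Bool | F y} : ℕ) : ZMod 2) = 0 := by
  obtain ⟨p, hp, hFp⟩ := hF
  rw [natCast_card_filter_expand hFp]
  refine Finset.sum_eq_zero fun e he => ?_
  have hlt : #e.support < #(Finset.univ : Finset (Fin m)) := by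
    rw [Finset.card_univ, Fintype.card_fin]
    exact (card_support_le hp he).trans_lt hd
  obtain ⟨i₀, -, hi₀⟩ := Finset.exists_mem_notMem_of_card_lt_card hlt
  rw [natCast_card_cylinder_eq_zero _ hi₀, mul_zero]

/-- Negation preserves algebraic degree. [folklore] -/
theorem isDegLeFun_not {d : ℕ} {f : (Fin m → Bool) → Bool} (hf : IsDegLeFun d f) :
    IsDegLeFun d (fun y => !f y) := by
  obtain ⟨p, hp, hfp⟩ := hf
  refine ⟨p + 1, ?_, fun y => ?_⟩
  · refine (MvPolynomial.totalDegree_add p 1).trans (max_le hp ?_)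
    rw [MvPolynomial.totalDegree_one]
    exact Nat.zero_le _
  · show (!f y) = polyPhase (p + 1) y
    rw [hfp y, polyPhase_apply, polyPhase_apply, map_add, map_one]
    rcases (by decide : ∀ z : ZMod 2, z = 0 ∨ z = 1) (MvPolynomial.eval (fun j => if y j then (1 : ZMod 2) else 0) p) with h | h <;>
      rw [h] <;> decide

/-- The conjunction (product) of functions of degrees `≤ d₁`, `≤ d₂` has degree `≤ d₁ + d₂`. [folklore] -/
theorem isDegLeFun_and {d₁ d₂ : ℕ} {f g : (Fin m → Bool) → Bool} (hf : IsDegLeFun d₁ f)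
    (hg : IsDegLeFun d₂ g) : IsDegLeFun (d₁ + d₂) (fun y => f y && g y) := by
  obtain ⟨p, hp, hfp⟩ := hf
  obtain ⟨p', hp', hgp⟩ := hg
  refine ⟨p * p', (MvPolynomial.totalDegree_mul p p').trans (add_le_add hp hp'), fun y => ?_⟩
  show (f y && g y) = polyPhase (p * p') y
  rw [hfp y, hgp y, polyPhase_apply, polyPhase_apply, polyPhase_apply, map_mul]
  rcases (by decide : ∀ z : ZMod 2, z = 0 ∨ z = 1) (MvPolynomial.eval (fun j => if y j then (1 : ZMod 2) else 0) p) with h | h <;>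
    rcases (by decide : ∀ z : ZMod 2, z = 0 ∨ z = 1) (MvPolynomial.eval (fun j => if y j then (1 : ZMod 2) else 0) p') with h' | h' <;>
      rw [h, h'] <;> decide

/-- A sum of odd integers over `A` is `≡ #A (mod 2)`. [folklore] -/
theorem intCast_sum_odd (A : Finset (Fin m → Bool)) (ε : (Fin m → Bool) → ℤ) (hε : ∀ y, Odd (ε y)) :
    ((∑ y ∈ A, ε y : ℤ) : ZMod 2) = ((#A : ℕ) : ZMod 2) := by
  push_cast
  rw [Finset.sum_congr rfl fun y _ => (hε y).intCast_zmod_two, Finset.sum_const, nsmul_eq_mul, mul_one]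

/-- `(1 - (-1)^{u}) (1 - (-1)^{v}) = 4[u ∧ v]`. [folklore] -/
theorem ind_mul_ind (u v : Bool) :
    (1 - (if u then (-1 : ℤ) else 1)) * (1 - (if v then (-1 : ℤ) else 1)) =
      if (u = true ∧ v = true) then 4 else 0 := by
  cases u <;> cases v <;> decide


/-! ### Lemma FOUR: four Boolean points with even first and second moments do not exist -/

/-- The pointwise Boolean identity behind Lemma FOUR (`256` cases). [folklore] -/
theorem four_points_aux : ∀ a0 a1 a2 a3 b0 b1 b2 b3 : Bool,
    ((a0 ^^ a1) ^^ (a2 ^^ a3)) = false → ((b0 ^^ b1) ^^ (b2 ^^ b3)) = false →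
    (((a0 && b0) ^^ (a1 && b1)) ^^ ((a2 && b2) ^^ (a3 && b3))) = false →
    ((a0 ^^ a1) && (b0 ^^ b2)) = ((b0 ^^ b1) && (a0 ^^ a2)) := by
  decide

/-- **Lemma FOUR.** Four pairwise distinct points `p₀,…,p₃ ∈ 𝔽₂^m` (three distinctness hypotheses
suffice) cannot have all coordinate sums `Σᵢ pᵢ(j)` and all pair sums `Σᵢ pᵢ(j)pᵢ(k)` (`j ≠ k`) even.
[folklore] -/
theorem four_points {p₀ p₁ p₂ p₃ : Fin m → Bool} (h01 : p₀ ≠ p₁) (h02 : p₀ ≠ p₂) (h12 : p₁ ≠ p₂)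
    (h1 : ∀ j, ((p₀ j ^^ p₁ j) ^^ (p₂ j ^^ p₃ j)) = false)
    (h2 : ∀ j k, j ≠ k →
      (((p₀ j && p₀ k) ^^ (p₁ j && p₁ k)) ^^ ((p₂ j && p₂ k) ^^ (p₃ j && p₃ k))) = false) :
    False := by
  -- `s = p₀ ⊕ p₁`, `t = p₀ ⊕ p₂` satisfy `s_j t_k = s_k t_j`
  have key : ∀ j k, j ≠ k → ((p₀ j ^^ p₁ j) && (p₀ k ^^ p₂ k)) = ((p₀ k ^^ p₁ k) && (p₀ j ^^ p₂ j)) :=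
    fun j k hjk => four_points_aux _ _ _ _ _ _ _ _ (h1 j) (h1 k) (h2 j k hjk)
  obtain ⟨j, hj⟩ := Function.ne_iff.mp h01
  obtain ⟨k, hk⟩ := Function.ne_iff.mp h02
  obtain ⟨l, hl⟩ := Function.ne_iff.mp h12
  have hs : (p₀ j ^^ p₁ j) = true := by revert hj; cases p₀ j <;> cases p₁ j <;> decide
  have ht : (p₀ k ^^ p₂ k) = true := by revert hk; cases p₀ k <;> cases p₂ k <;> decide
  have hl' : (p₀ l ^^ p₁ l) ≠ (p₀ l ^^ p₂ l) := by
    revert hl; cases p₀ l <;> cases p₁ l <;> cases p₂ l <;> decide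
  cases htj : (p₀ j ^^ p₂ j)
  · -- then `t` vanishes off `j`, and at `j`: contradiction with `t k = 1`
    by_cases hkj : k = j
    · rw [hkj, htj] at ht
      exact Bool.false_ne_true ht
    · have := key j k (Ne.symm hkj)
      rw [hs, htj, ht, Bool.true_and, Bool.and_false] at this
      exact Bool.false_ne_true this.symm
  · -- then `s = t`, contradiction with `p₁ ≠ p₂`
    apply hl'
    by_cases hlj : l = j
    · rw [hlj, hs, htj]
    · have := key j l (Ne.symm hlj)
      rw [hs, htj, Bool.true_and, Bool.and_true] at this
      exact this.symm

/-- A sum of four indicators vanishes in `𝔽₂` iff their XOR does. [folklore] -/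
theorem bool_sum_four (f : Bool × Bool → Bool) :
    (∑ uv : Bool × Bool, if f uv then (1 : ZMod 2) else 0) = 0 ↔
      ((f (false, false) ^^ f (false, true)) ^^ (f (true, false) ^^ f (true, true))) = false := by
  rw [Fintype.sum_prod_type]
  simp only [Fintype.sum_bool]
  cases f (false, false) <;> cases f (false, true) <;> cases f (true, false) <;> cases f (true, true) <;> decide

end Summit.QuantumAdvantage.QuantumAdvantage.Theorems.NearExactIsExact.Negative.CentroidMoments
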